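import Literature.Combinatorics.Sahi2008.GeneratingFunction
import Mathlib.RingTheory.PowerSeries.Log

/-!
# Lieb–Sahi's `G(F) = exp 𝔼(log F)` is Sahi's `∏_S (1 - F(S))^{μ(S)}`

CITATION HEADER.  E. H. Lieb, S. Sahi, *On the extension of the FKG inequality to `n` functions*,
J. Math. Phys. **63** (2022) [LiebSahi2021], p. 3–4 and Conjecture 1.2:
`G(F) = exp(𝔼(log F))`, `F(x,t) = 1 - Σ_i f_i(x) t^i`, "Conjecture 1.2 ([sahi], Conjecture 4) …
`1 - G(F) = Σ_n c_n t^n`, `c_n ≥ 0` for all `n`"; S. Sahi, *Higher correlation inequalities*,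
Combinatorica **28** (2008) [Sahi2008], eq. (3)/(14): `1 - ∏_{S ⊆ X} (1 - F(S))^{μ(S)}`, and the
proof of Proposition 12 (p. 219): "Taking log of both sides, we get
`log Π = Σ_S μ(S) log(1 - F_n(S)) = E(log(1 - F_n))`".

The tree's `Literature.Combinatorics.Sahi2008.sahiSeries μ f` (file `GeneratingFunction.lean`) reads the
real power `(1 - u)^c`, `u ∈ tℝ⟦t⟧`, as the binomial series (Mathlib's `PowerSeries.binomialSeries ℝ c`
at `-u`).  This file PROVES that this is the same power series as Lieb–Sahi's
`exp(𝔼 log F) = exp(Σ_x μ(x) log(1 - A(x)))` (Mathlib's `PowerSeries.exp`, `PowerSeries.log = log(1+X)`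
and `PowerSeries.subst`):

* `binomialSeries_eq_exp_subst_smul_log` — `(1+X)^c = exp(c·log(1+X))` in `ℝ⟦X⟧` (both solve
  `(1+X)·Y' = c·Y`, `Y(0) = 1`; compared through `exp(-c log(1+X))·(1+X)^c`, which has zero
  derivative, and Mathlib's `PowerSeries.derivative.ext`);
* `liebSahiSeries μ f := 1 - exp(Σ_x μ(x)·log(1 - A(x)))` and
  **`liebSahiSeries_eq_sahiSeries`**: it equals `sahiSeries μ f` for every weight `μ`;
* hence Theorem 4.4 / the equivalence of Conjectures 1.1 and 1.2 hold verbatim for Lieb–Sahi's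
  `G(F)` (`forall_sahiPositive_iff_liebSahiSeries`).

Standard facts about `exp ∘ f` (`exp(f+g) = exp f · exp g` for `f(0) = g(0) = 0`, by the
derivative) are re-derived here as private lemmas (the tree has them in
`Literature/AlgebraicGeometry/Motives/FrobeniusTraceProofs.lean`, whose import closure is unrelated).
Everything is PROVED; axioms standard.
-/

set_option autoImplicit false

namespace Literature.Combinatorics.Sahi2008

open Finset PowerSeries

/-! ### `exp ∘ f` for `f` without constant term (standard) -/

section ExpSubst

/-- `exp(f)` has constant term `1` when `f(0) = 0`. [folklore] -/
private theorem constantCoeff_exp_subst {f : ℝ⟦X⟧} (hf : constantCoeff f = 0) :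
    constantCoeff ((exp ℝ).subst f) = 1 := by
  rw [← coeff_zero_eq_constantCoeff_apply, coeff_subst' (HasSubst.of_constantCoeff_zero' hf),
    finsum_eq_single _ 0]
  · simp
  · intro d hd
    rw [coeff_zero_eq_constantCoeff_apply, map_pow, hf, zero_pow hd, smul_zero]

/-- Chain rule `(exp f)' = exp f · f'`. [folklore] -/
private theorem derivative_exp_subst {f : ℝ⟦X⟧} (hf : constantCoeff f = 0) :
    d⁄dX ℝ ((exp ℝ).subst f) = (exp ℝ).subst f * d⁄dX ℝ f := by
  rw [derivative_subst ℝ (HasSubst.of_constantCoeff_zero' hf), derivative_exp]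

/-- `exp(f)·exp(-f) = 1`. [folklore] -/
private theorem exp_subst_mul_exp_subst_neg {f : ℝ⟦X⟧} (hf : constantCoeff f = 0) :
    (exp ℝ).subst f * (exp ℝ).subst (-f) = 1 := by
  have hf' : constantCoeff (-f) = 0 := by rw [map_neg, hf, neg_zero]
  refine derivative.ext ?_ ?_
  · rw [Derivation.leibniz, derivative_exp_subst hf, derivative_exp_subst hf', map_neg,
      Derivation.map_one_eq_zero, smul_eq_mul, smul_eq_mul]
    ring
  · rw [map_mul, constantCoeff_exp_subst hf, constantCoeff_exp_subst hf', map_one, mul_one]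

/-- Functional equation `exp(f + g) = exp f · exp g` for `f(0) = g(0) = 0`. [folklore] -/
private theorem exp_subst_add {f g : ℝ⟦X⟧} (hf : constantCoeff f = 0) (hg : constantCoeff g = 0) :
    (exp ℝ).subst (f + g) = (exp ℝ).subst f * (exp ℝ).subst g := by
  have hfg : constantCoeff (f + g) = 0 := by rw [map_add, hf, hg, add_zero]
  have hf' : constantCoeff (-f) = 0 := by rw [map_neg, hf, neg_zero]
  have hg' : constantCoeff (-g) = 0 := by rw [map_neg, hg, neg_zero]
  have hQ : (exp ℝ).subst (f + g) * ((exp ℝ).subst (-f) * (exp ℝ).subst (-g)) = 1 := by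
    refine derivative.ext ?_ ?_
    · simp only [Derivation.leibniz, derivative_exp_subst hfg, derivative_exp_subst hf',
        derivative_exp_subst hg', map_neg, map_add, Derivation.map_one_eq_zero, smul_eq_mul]
      ring
    · simp only [map_mul, constantCoeff_exp_subst hfg, constantCoeff_exp_subst hf',
        constantCoeff_exp_subst hg', map_one, mul_one]
  have h1 := exp_subst_mul_exp_subst_neg hf
  have h2 := exp_subst_mul_exp_subst_neg hg
  calc (exp ℝ).subst (f + g)
      = (exp ℝ).subst (f + g) * (((exp ℝ).subst f * (exp ℝ).subst (-f)) *
          ((exp ℝ).subst g * (exp ℝ).subst (-g))) := by rw [h1, h2, mul_one, mul_one]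
    _ = (exp ℝ).subst (f + g) * ((exp ℝ).subst (-f) * (exp ℝ).subst (-g)) *
          ((exp ℝ).subst f * (exp ℝ).subst g) := by ring
    _ = (exp ℝ).subst f * (exp ℝ).subst g := by rw [hQ, one_mul]

/-- `exp(0) = 1`. [folklore] -/
private theorem exp_subst_zero : (exp ℝ).subst (0 : ℝ⟦X⟧) = 1 := by
  rw [subst_zero_eq_C_constantCoeff, constantCoeff_exp, map_one, map_one]

/-- `exp(Σ_a f_a) = ∏_a exp(f_a)` for `f_a(0) = 0`. [folklore] -/
private theorem exp_subst_sum {β : Type*} (s : Finset β) (f : β → ℝ⟦X⟧)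
    (hf : ∀ a ∈ s, constantCoeff (f a) = 0) :
    (exp ℝ).subst (∑ a ∈ s, f a) = ∏ a ∈ s, (exp ℝ).subst (f a) := by
  classical
  induction s using Finset.induction_on with
  | empty => rw [sum_empty, prod_empty, exp_subst_zero]
  | insert a s ha ih =>
    have hs : ∀ b ∈ s, constantCoeff (f b) = 0 := fun b hb => hf b (mem_insert_of_mem hb)
    have hsum : constantCoeff (∑ b ∈ s, f b) = 0 := by
      rw [map_sum]; exact Finset.sum_eq_zero hs
    rw [sum_insert ha, prod_insert ha, exp_subst_add (hf a (mem_insert_self a s)) hsum, ih hs]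

end ExpSubst

/-! ### `(1+X)^c = exp(c·log(1+X))` -/

section Binomial

/-- The absorption identity `(n+1)·C(c,n+1) = (c-n)·C(c,n)` for the generalised binomial
coefficients over `ℝ`. [folklore] -/
private theorem succ_mul_choose_succ (c : ℝ) (n : ℕ) :
    ((n : ℝ) + 1) * Ring.choose c (n + 1) = (c - n) * Ring.choose c n := by
  have hev : ∀ k, (descPochhammer ℤ k).smeval c = (descPochhammer ℝ k).eval c := by
    intro k
    rw [← Polynomial.aeval_eq_smeval, Polynomial.aeval_def, Polynomial.eval₂_eq_eval_map,
      descPochhammer_map]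
  rw [Ring.choose_eq_smul, Ring.choose_eq_smul, hev, hev, descPochhammer_succ_eval, smul_eq_mul,
    smul_eq_mul, Nat.factorial_succ]
  have h1 : ((n + 1).factorial : ℝ) ≠ 0 := by positivity
  have h2 : (n.factorial : ℝ) ≠ 0 := by positivity
  push_cast
  field_simp

/-- `log(1+X)` may be substituted (no constant term); so may `c·log(1+X)`. [folklore] -/
private theorem constantCoeff_smul_log (c : ℝ) : constantCoeff (c • PowerSeries.log ℝ) = 0 := by
  rw [smul_eq_C_mul, map_mul, constantCoeff_log, mul_zero]

/-- `(1+X)·(log(1+X))' = 1`. [folklore] -/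
private theorem one_add_X_mul_deriv_log : (1 + X) * d⁄dX ℝ (PowerSeries.log ℝ) = 1 := by
  rw [deriv_log]
  ext n
  rw [add_mul, one_mul, map_add, PowerSeries.coeff_one]
  cases n with
  | zero => simp
  | succ n =>
    rw [coeff_succ_X_mul, coeff_mk, coeff_mk, if_neg (Nat.succ_ne_zero n), ← map_add,
      pow_succ, mul_neg_one, neg_add_cancel, map_zero]

/-- `(1+X)·((1+X)^c)' = c·(1+X)^c` for the binomial series. [folklore] -/
private theorem one_add_X_mul_deriv_binomialSeries (c : ℝ) :
    (1 + X) * d⁄dX ℝ (PowerSeries.binomialSeries ℝ c) = c • PowerSeries.binomialSeries ℝ c := by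
  ext n
  have hcoefd : ∀ k, coeff k (d⁄dX ℝ (PowerSeries.binomialSeries ℝ c)) =
      Ring.choose c (k + 1) * ((k : ℝ) + 1) := by
    intro k
    rw [coeff_derivative, binomialSeries_coeff, smul_eq_mul, mul_one]
  rw [add_mul, one_mul, map_add, PowerSeries.coeff_smul, binomialSeries_coeff, smul_eq_mul, smul_eq_mul,
    mul_one, hcoefd]
  cases n with
  | zero =>
    rw [coeff_zero_X_mul, add_zero, Ring.choose_zero_right, zero_add, Ring.choose_one_right,
      Nat.cast_zero, zero_add, mul_one]
  | succ n =>
    rw [coeff_succ_X_mul, hcoefd]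
    have h := succ_mul_choose_succ c (n + 1)
    push_cast at h ⊢
    linear_combination h

/-- `(1+X)·(exp(c log(1+X)))' = c·exp(c log(1+X))`. [folklore] -/
private theorem one_add_X_mul_deriv_expLog (c : ℝ) :
    (1 + X) * d⁄dX ℝ ((exp ℝ).subst (c • PowerSeries.log ℝ)) =
      c • (exp ℝ).subst (c • PowerSeries.log ℝ) := by
  rw [derivative_exp_subst (constantCoeff_smul_log c), Derivation.map_smul]
  calc (1 + X) * ((exp ℝ).subst (c • PowerSeries.log ℝ) * (c • d⁄dX ℝ (PowerSeries.log ℝ)))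
      = c • ((exp ℝ).subst (c • PowerSeries.log ℝ) * ((1 + X) * d⁄dX ℝ (PowerSeries.log ℝ))) := by
        rw [mul_smul_comm, mul_smul_comm]
        congr 1
        ring
    _ = _ := by rw [one_add_X_mul_deriv_log, mul_one]

/-- **`(1+X)^c = exp(c·log(1+X))` in `ℝ⟦X⟧`** for every real `c`: Mathlib's binomial series
`Σ_k C(c,k) X^k` is the exponential of `c·log(1+X)` — the formal identity behind Sahi's "taking log of
both sides" of `∏_S (1 - F_n(S))^{μ(S)}` and Lieb–Sahi's `G(F) = exp 𝔼(log F)`.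
[cite: Sahi2008, proof of Prop. 12 (p. 219); LiebSahi2021, Prop. 4.2 (Appendix)] -/
theorem binomialSeries_eq_exp_subst_smul_log (c : ℝ) :
    PowerSeries.binomialSeries ℝ c = (exp ℝ).subst (c • PowerSeries.log ℝ) := by
  set B := PowerSeries.binomialSeries ℝ c with hB
  set E := (exp ℝ).subst (c • PowerSeries.log ℝ) with hE
  set Em := (exp ℝ).subst ((-c) • PowerSeries.log ℝ) with hEm
  -- `W = exp(-c log(1+X)) · B` has zero derivative
  have hEm' : (1 + X) * d⁄dX ℝ Em = (-c) • Em := one_add_X_mul_deriv_expLog (-c)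
  have hW : (1 + X) * d⁄dX ℝ (Em * B) = 0 := by
    rw [Derivation.leibniz, smul_eq_mul, smul_eq_mul, mul_add]
    calc (1 + X) * (Em * d⁄dX ℝ B) + (1 + X) * (B * d⁄dX ℝ Em)
        = Em * ((1 + X) * d⁄dX ℝ B) + B * ((1 + X) * d⁄dX ℝ Em) := by ring
      _ = 0 := by rw [one_add_X_mul_deriv_binomialSeries, hEm', smul_eq_C_mul, smul_eq_C_mul,
          map_neg]; ring
  have hunit : IsUnit (1 + X : ℝ⟦X⟧) := by
    rw [isUnit_iff_constantCoeff, map_add, map_one, constantCoeff_X, add_zero]; exact isUnit_one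
  have hW' : d⁄dX ℝ (Em * B) = 0 := by
    obtain ⟨u, hu⟩ := hunit
    have := congrArg (fun z => (↑u⁻¹ : ℝ⟦X⟧) * z) hW
    simpa [← mul_assoc, ← hu] using this
  have hW1 : Em * B = 1 := by
    refine derivative.ext (by rw [hW', Derivation.map_one_eq_zero]) ?_
    rw [map_mul, hEm, constantCoeff_exp_subst (constantCoeff_smul_log (-c)),
      binomialSeries_constantCoeff, map_one, mul_one]
  -- `E · Em = 1`
  have hEEm : E * Em = 1 := by
    rw [hE, hEm, neg_smul]
    exact exp_subst_mul_exp_subst_neg (constantCoeff_smul_log c)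
  calc B = (E * Em) * B := by rw [hEEm, one_mul]
    _ = E * (Em * B) := by ring
    _ = E := by rw [hW1, mul_one]

/-- The real power `(1-u)^c` of a series `1 - u`, `u ∈ tℝ⟦t⟧`, in Sahi's product is the exponential
`exp(c·log(1-u))`. [cite: Sahi2008, proof of Prop. 12 (p. 219): "Taking log of both sides"] -/
theorem binomialSeries_subst_neg_eq_exp (c : ℝ) {u : ℝ⟦X⟧} (hu : constantCoeff u = 0) :
    (PowerSeries.binomialSeries ℝ c).subst (-u) =
      (exp ℝ).subst (c • (PowerSeries.log ℝ).subst (-u)) := by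
  have hu' : constantCoeff (-u) = 0 := by rw [map_neg, hu, neg_zero]
  have hs : HasSubst (-u) := HasSubst.of_constantCoeff_zero' hu'
  rw [binomialSeries_eq_exp_subst_smul_log,
    subst_comp_subst_apply (HasSubst.of_constantCoeff_zero' (constantCoeff_smul_log c)) hs,
    subst_smul hs]

end Binomial

/-! ### Lieb–Sahi's `1 - G(F)` -/

section LiebSahi

variable {α : Type*} [Fintype α]

/-- **Lieb–Sahi's generating function** `1 - G(F)`, `G(F) = exp(𝔼 log F)`, `F(x) = 1 - Σ_{i≥1} f_i(x) t^i`: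
`1 - exp(Σ_x μ(x)·log(1 - A(x)))` with Mathlib's `exp`, `log(1+X)` and substitution.
[cite: LiebSahi2021, Conj. 1.2 and the display before it (`G(F) = exp(𝔼(log F))`); Sahi2008, p. 219] -/
noncomputable def liebSahiSeries (μ : α → ℝ) (f : ℕ → α → ℝ) : ℝ⟦X⟧ :=
  1 - (exp ℝ).subst (∑ x, μ x • (PowerSeries.log ℝ).subst (-genA f x))

/-- **`1 - exp 𝔼 log F = 1 - ∏_x (1 - A(x))^{μ(x)}`**: Lieb–Sahi's `1 - G(F)` IS Sahi's series
(3)/(14) (the tree's `sahiSeries`), for every weight `μ` on a finite set.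
[cite: Sahi2008, proof of Prop. 12 (p. 219) (`log Π = Σ_S μ(S) log(1 - F_n(S)) = E(log(1-F_n))`);
LiebSahi2021, Conj. 1.2] -/
theorem liebSahiSeries_eq_sahiSeries (μ : α → ℝ) (f : ℕ → α → ℝ) :
    liebSahiSeries μ f = sahiSeries μ f := by
  rw [liebSahiSeries, sahiSeries]
  congr 1
  have hL : ∀ x, constantCoeff ((PowerSeries.log ℝ).subst (-genA f x)) = 0 := by
    intro x
    have h0 : constantCoeff (-genA f x) = 0 := by rw [map_neg, constantCoeff_genA, neg_zero]
    exact constantCoeff_subst_eq_zero h0 _ constantCoeff_log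
  rw [exp_subst_sum _ _ (fun x _ => by rw [smul_eq_C_mul, map_mul, hL x, mul_zero])]
  refine Finset.prod_congr rfl fun x _ => ?_
  rw [binomialSeries_subst_neg_eq_exp (μ x) (constantCoeff_genA f x)]

/-- **Theorem 4.4 for Lieb–Sahi's own `G(F)`**: for a probability weight `μ` on a finite preorder,
`(∀ n, SahiPositive μ n)` iff all coefficients of `1 - exp 𝔼 log(1 - Σ_i f_i t^i)` are nonnegative for
all sequences of nonnegative monotone `f_i` (Conjectures 1.1 and 1.2 are equivalent, verbatim).
[cite: LiebSahi2021, Thm. 4.4 and Conjs. 1.1/1.2] -/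
theorem forall_sahiPositive_iff_liebSahiSeries [Preorder α] (μ : α → ℝ) (hμ : ∑ x, μ x = 1) :
    (∀ n, SahiPositive μ n) ↔
      ∀ f : ℕ → α → ℝ, (∀ i x, 0 ≤ f i x) → (∀ i, Monotone (f i)) →
        ∀ M, 0 ≤ coeff M (liebSahiSeries μ f) := by
  simp only [liebSahiSeries_eq_sahiSeries]
  exact forall_sahiPositive_iff_sahiSeries μ hμ

end LiebSahi

end Literature.Combinatorics.Sahi2008
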